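import Literature.Geometry.Symplectic.SymplecticNormalRealization
import Mathlib.Analysis.Calculus.ContDiff.FiniteDimension
import HarnessLib

/-!
# Smoothness of the symplectic normal frame

McDuff–Salamon, *Introduction to Symplectic Topology* (3rd ed. 2017), Prop. 2.5.6 / Prop. 2.6.4:
the compatible complex structure `J_{g,ω}` depends SMOOTHLY on `(g, ω)` ("the map (2.5.9) is
smooth"), so the symplectic complement splitting `V = d(W) ⊕ d(W)^ω` (Lemma 2.1.1) and its adapted
complex structure `J̃` vary smoothly with smooth data. Part 2 of `SymplecticSplittingIso.lean`
proved the CONTINUOUS dependence of the splitting data `Ω_a, d† Ω_a d, L, π_F, π_G, J̃` on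
`(a, d, J)`; this file upgrades it to `C^∞` dependence (`ContMDiffOn` over a manifold of
parameters), and reads it on the chart data of a smooth `2`-form `s` on `N`, a `C^∞` map
`b : S → N` and a `C^∞` almost complex structure `J`:

* `SymplecticSplitting.contMDiffOn_projG`, `contMDiffOn_adaptedJ`, `contMDiffOn_lineVec` — the
  splitting projection, the adapted complex structure and the frame vector `(x, z) ↦ z · n(x)` are
  `C^∞` in `C^∞` data (inversion is `C^∞` on invertible operators,
  `ContinuousLinearMap.IsInvertible.contDiffAt_map_inverse`; the tree's `contDiffOn_polarJOfMetric`);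
* `SymplecticSplitting.contMDiffOn_chartForm`, `contMDiffOn_chartDeriv`, `contMDiffOn_coordJ_comp` —
  the chart data `y ↦ (s, db, J)` read in the charts at `y₀`, `b y₀` are `C^∞` on the chart domain
  (the form and `J` are `C^∞` sections; the derivative is the `C^∞` tangent map read in the `C^∞`
  tangent trivialisations, `contDiffOn_clm_apply` for the operator-valued map);
* `SymplecticSplitting.contMDiffOn_chartFrame`, `contMDiffOn_chartLineVec` — **the chart frame
  `y ↦ π_G'(y) n₀` and the chart expression `(y, z) ↦ z · (chart frame)` of the realisation map
  `normalMap : E(ν) → TN` are `C^∞`**, and `contMDiffOn_totalSpaceMk_rawFrame`: the raw frame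
  `y ↦ (b y, ñ(y₀; y)) ∈ TN` is a `C^∞` map into the tangent bundle on the chart domain.

This is brick B1b of the tubular neighbourhood of a symplectic surface (towards
`⟨c₁(ν_S), [S]⟩ = S·S`, McDuff–Salamon 2017, Ex. 4.4.5). Everything is proved; no named facts.

## References

* [McDuffSalamon2017] D. McDuff, D. Salamon, Introduction to Symplectic Topology, 3rd ed., OUP
  2017, Lemma 2.1.1, Prop. 2.5.6, Prop. 2.6.4, §3.4.
-/

noncomputable section

open scoped Manifold ContDiff Topology RealInnerProductSpace
open Function Module Set Bundle Complex Literature.Geometry.Kaehler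

namespace Literature.Geometry.Symplectic

namespace SymplecticSplitting

/-! ### `C^∞` dependence of the splitting data on `(a, d, J)` -/

section SmoothData

variable {V : Type*} [NormedAddCommGroup V] [InnerProductSpace ℝ V] [FiniteDimensional ℝ V]
  [CompleteSpace V] {W : Type*} [NormedAddCommGroup W] [InnerProductSpace ℝ W] [FiniteDimensional ℝ W]
  [CompleteSpace W]
  {EX : Type*} [NormedAddCommGroup EX] [NormedSpace ℝ EX] {HX : Type*} [TopologicalSpace HX]
  {IX : ModelWithCorners ℝ EX HX} {X : Type*} [TopologicalSpace X] [ChartedSpace HX X]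
  {U : Set X} {a : X → V [⋀^Fin 2]→L[ℝ] ℝ} {d : X → W →L[ℝ] V} {J : X → V →L[ℝ] V}

/-- A `C^n` map of vector spaces composed with a `C^n` map on a set is `C^n` on the set
(Mathlib has the `WithinAt`/`At`/global forms). [folklore] -/
theorem _root_.ContDiff.comp_contMDiffOn' {F F' : Type*} [NormedAddCommGroup F] [NormedSpace ℝ F]
    [NormedAddCommGroup F'] [NormedSpace ℝ F'] {n : ℕ∞ω} {g : F → F'} {f : X → F} {s : Set X}
    (hg : ContDiff ℝ n g) (hf : ContMDiffOn IX 𝓘(ℝ, F) n f s) :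
    ContMDiffOn IX 𝓘(ℝ, F') n (g ∘ f) s := fun x hx ↦
  hg.comp_contMDiffWithinAt (hf x hx)

set_option synthInstance.maxHeartbeats 400000 in
omit [CompleteSpace V] in
/-- `α ↦ Ω_α = gram (bilinOfAlt α)` is `C^∞` (it is continuous linear). [folklore] -/
theorem contDiff_gram_bilinOfAlt : ContDiff ℝ ∞ fun α : V [⋀^Fin 2]→L[ℝ] ℝ ↦ gram (bilinOfAlt α) :=
  (gram : (V →L[ℝ] V →L[ℝ] ℝ) →L[ℝ] (V →L[ℝ] V)).contDiff.comp contDiff_bilinOfAlt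

omit [FiniteDimensional ℝ V] in
/-- `T ↦ T†` is `C^∞` on `V →L[ℝ] V`. [folklore] -/
theorem contDiff_adjointV : ContDiff ℝ ∞ fun T : V →L[ℝ] V ↦ ContinuousLinearMap.adjoint T :=
  (ContinuousLinearMap.adjoint : (V →L[ℝ] V) ≃ₗᵢ⋆[ℝ] (V →L[ℝ] V)).toContinuousLinearEquiv.contDiff

omit [FiniteDimensional ℝ V] [FiniteDimensional ℝ W] in
/-- `δ ↦ δ†` is `C^∞` on `W →L[ℝ] V`. [folklore] -/
theorem contDiff_adjointWV : ContDiff ℝ ∞ fun δ : W →L[ℝ] V ↦ ContinuousLinearMap.adjoint δ :=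
  (ContinuousLinearMap.adjoint : (W →L[ℝ] V) ≃ₗᵢ⋆[ℝ] (V →L[ℝ] W)).toContinuousLinearEquiv.contDiff

variable (ha : ContMDiffOn IX 𝓘(ℝ, V [⋀^Fin 2]→L[ℝ] ℝ) ∞ a U) (hd : ContMDiffOn IX 𝓘(ℝ, W →L[ℝ] V) ∞ d U)
include ha hd

omit [CompleteSpace V] [FiniteDimensional ℝ W] [CompleteSpace W] in
omit hd in
/-- **`x ↦ Ω_{a_x}` is `C^∞`.** [folklore] -/
theorem contMDiffOn_formOp : ContMDiffOn IX 𝓘(ℝ, V →L[ℝ] V) ∞ (fun x ↦ formOp (a x)) U :=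
  contDiff_gram_bilinOfAlt.comp_contMDiffOn' ha

omit [FiniteDimensional ℝ W] in
/-- **`x ↦ d_x† Ω_{a_x} d_x` is `C^∞`.** [folklore] -/
theorem contMDiffOn_pullbackOp : ContMDiffOn IX 𝓘(ℝ, W →L[ℝ] W) ∞ (fun x ↦ pullbackOp (a x) (d x)) U :=
  (contDiff_adjointWV.comp_contMDiffOn' hd).clm_comp ((contMDiffOn_formOp ha).clm_comp hd)

/-- **The inverse `(d† Ω_a d)⁻¹` is `C^∞`** where `d^* a` is nondegenerate (inversion is `C^∞` on
invertible operators). [folklore] -/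
theorem contMDiffOn_inverse_pullbackOp
    (hnd : ∀ x ∈ U, ∀ u : W, u ≠ 0 → ∃ u' : W, a x ![d x u, d x u'] ≠ 0) :
    ContMDiffOn IX 𝓘(ℝ, W →L[ℝ] W) ∞ (fun x ↦ (pullbackOp (a x) (d x)).inverse) U := fun x hx ↦
  ContDiffAt.comp_contMDiffWithinAt (g := ContinuousLinearMap.inverse)
    (f := fun x ↦ pullbackOp (a x) (d x))
    ((isInvertible_pullbackOp (hnd x hx)).contDiffAt_map_inverse (n := ∞))
    (contMDiffOn_pullbackOp ha hd x hx)

/-- **`x ↦ L_x` is `C^∞`.** [folklore] -/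
theorem contMDiffOn_leftInv (hnd : ∀ x ∈ U, ∀ u : W, u ≠ 0 → ∃ u' : W, a x ![d x u, d x u'] ≠ 0) :
    ContMDiffOn IX 𝓘(ℝ, V →L[ℝ] W) ∞ (fun x ↦ leftInv (a x) (d x)) U :=
  (contMDiffOn_inverse_pullbackOp ha hd hnd).clm_comp
    ((contDiff_adjointWV.comp_contMDiffOn' hd).clm_comp (contMDiffOn_formOp ha))

/-- **`x ↦ π_F(x)` is `C^∞`.** [folklore] -/
theorem contMDiffOn_projF (hnd : ∀ x ∈ U, ∀ u : W, u ≠ 0 → ∃ u' : W, a x ![d x u, d x u'] ≠ 0) :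
    ContMDiffOn IX 𝓘(ℝ, V →L[ℝ] V) ∞ (fun x ↦ projF (a x) (d x)) U :=
  hd.clm_comp (contMDiffOn_leftInv ha hd hnd)

/-- **`x ↦ π_G(x)` is `C^∞`** (McDuff–Salamon 2017, Lemma 2.1.1: the symplectic complement
splitting depends smoothly on smooth data). [cite: McDuffSalamon2017, §2.1 Lemma 2.1.1] -/
theorem contMDiffOn_projG (hnd : ∀ x ∈ U, ∀ u : W, u ≠ 0 → ∃ u' : W, a x ![d x u, d x u'] ≠ 0) :
    ContMDiffOn IX 𝓘(ℝ, V →L[ℝ] V) ∞ (fun x ↦ projG (a x) (d x)) U :=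
  contMDiffOn_const.sub (contMDiffOn_projF ha hd hnd)

variable (hJ : ContMDiffOn IX 𝓘(ℝ, V →L[ℝ] V) ∞ J U)
include hJ

/-- **The Gram operator of the block metric of `g_J` is `C^∞`.** [folklore] -/
theorem contMDiffOn_gram_blockMetric (hnd : ∀ x ∈ U, ∀ u : W, u ≠ 0 → ∃ u' : W, a x ![d x u, d x u'] ≠ 0) :
    ContMDiffOn IX 𝓘(ℝ, V →L[ℝ] V) ∞ (fun x ↦ gram (blockMetric (a x) (d x) (tameMetric (a x) (J x)))) U := by
  have hΩ := contMDiffOn_formOp (IX := IX) ha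
  have hG : ContMDiffOn IX 𝓘(ℝ, V →L[ℝ] V) ∞ (fun x ↦ gram (tameMetric (a x) (J x))) U := by
    have h := ((contDiff_adjointV.comp_contMDiffOn' hJ).clm_comp hΩ).sub (hΩ.clm_comp hJ)
    refine h.congr fun x _ ↦ ?_
    rw [gram_tameMetric (a x) (J x)]
    rfl
  have hF := contMDiffOn_projF ha hd hnd
  have hG' := contMDiffOn_projG ha hd hnd
  have h := (((contDiff_adjointV.comp_contMDiffOn' hF).clm_comp hG).clm_comp hF).add
    (((contDiff_adjointV.comp_contMDiffOn' hG').clm_comp hG).clm_comp hG')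
  refine h.congr fun x _ ↦ ?_
  rw [gram_blockMetric (a x) (d x) _]
  rfl

/-- **`x ↦ J̃_x` is `C^∞`** (smoothness of `(g, ω) ↦ J_{g,ω}`, McDuff–Salamon 2017, Prop. 2.5.6
"the map (2.5.9) is smooth"; the tree's `contDiffOn_polarJOfMetric`).
[cite: McDuffSalamon2017, Prop. 2.5.6] -/
theorem contMDiffOn_adaptedJ (hau : ∀ x ∈ U, ∀ v : V, v ≠ 0 → ∃ w : V, a x ![v, w] ≠ 0)
    (hnd : ∀ x ∈ U, ∀ u : W, u ≠ 0 → ∃ u' : W, a x ![d x u, d x u'] ≠ 0)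
    (hJt : ∀ x ∈ U, ∀ v : V, v ≠ 0 → 0 < a x ![v, J x v]) :
    ContMDiffOn IX 𝓘(ℝ, V →L[ℝ] V) ∞ (fun x ↦ adaptedJ (a x) (d x) (J x)) U := by
  have hΩ := contMDiffOn_formOp (IX := IX) ha
  have hpair : ContMDiffOn IX 𝓘(ℝ, (V →L[ℝ] V) × (V →L[ℝ] V)) ∞
      (fun x ↦ (gram (blockMetric (a x) (d x) (tameMetric (a x) (J x))), formOp (a x))) U :=
    (contMDiffOn_gram_blockMetric ha hd hJ hnd).prodMk_space hΩ
  have hmaps : U ⊆ (fun x ↦ (gram (blockMetric (a x) (d x) (tameMetric (a x) (J x))), formOp (a x))) ⁻¹'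
      polarDomain V := fun x hx ↦
    ⟨isPosDefSymm_gram_blockMetric (hJt x hx), isSkewNondeg_formOp (hau x hx)⟩
  intro x hx
  have hat : ContDiffWithinAt ℝ ∞ (fun p : (V →L[ℝ] V) × (V →L[ℝ] V) ↦ polarJOfMetric p.1 p.2) (polarDomain V)
      (gram (blockMetric (a x) (d x) (tameMetric (a x) (J x))), formOp (a x)) :=
    contDiffOn_polarJOfMetric _ (hmaps hx)
  have h := hat.comp_contMDiffWithinAt
    (f := fun x ↦ (gram (blockMetric (a x) (d x) (tameMetric (a x) (J x))), formOp (a x))) (x := x)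
    (hpair x hx) hmaps
  exact h

/-- **`(x, z) ↦ z · n(x)` is `C^∞`** on `U × ℂ` when the data `a, d, J` and the frame `n` are `C^∞`
on `U`. [folklore] -/
theorem contMDiffOn_lineVec {n : X → V} (hn : ContMDiffOn IX 𝓘(ℝ, V) ∞ n U)
    (hau : ∀ x ∈ U, ∀ v : V, v ≠ 0 → ∃ w : V, a x ![v, w] ≠ 0)
    (hnd : ∀ x ∈ U, ∀ u : W, u ≠ 0 → ∃ u' : W, a x ![d x u, d x u'] ≠ 0)
    (hJt : ∀ x ∈ U, ∀ v : V, v ≠ 0 → 0 < a x ![v, J x v]) :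
    ContMDiffOn (IX.prod 𝓘(ℝ, ℂ)) 𝓘(ℝ, V) ∞
      (fun q : X × ℂ ↦ lineVec (a q.1) (d q.1) (J q.1) (n q.1) q.2) (U ×ˢ univ) := by
  have hJn : ContMDiffOn IX 𝓘(ℝ, V) ∞ (fun x ↦ adaptedJ (a x) (d x) (J x) (n x)) U :=
    (contMDiffOn_adaptedJ ha hd hJ hau hnd hJt).clm_apply hn
  have h1 : ContMDiffOn (IX.prod 𝓘(ℝ, ℂ)) 𝓘(ℝ, V) ∞ (fun q : X × ℂ ↦ n q.1) (U ×ˢ univ) :=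
    hn.comp contMDiffOn_fst fun q hq ↦ hq.1
  have h2 : ContMDiffOn (IX.prod 𝓘(ℝ, ℂ)) 𝓘(ℝ, V) ∞
      (fun q : X × ℂ ↦ adaptedJ (a q.1) (d q.1) (J q.1) (n q.1)) (U ×ˢ univ) :=
    hJn.comp contMDiffOn_fst fun q hq ↦ hq.1
  have hre : ContMDiff (IX.prod 𝓘(ℝ, ℂ)) 𝓘(ℝ) ∞ fun q : X × ℂ ↦ q.2.re :=
    ((Complex.reCLM.contDiff (n := ∞)).comp_contMDiff contMDiff_snd)
  have him : ContMDiff (IX.prod 𝓘(ℝ, ℂ)) 𝓘(ℝ) ∞ fun q : X × ℂ ↦ q.2.im :=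
    ((Complex.imCLM.contDiff (n := ∞)).comp_contMDiff contMDiff_snd)
  have h := (hre.contMDiffOn.smul h1).add (him.contMDiffOn.smul h2)
  refine h.congr fun q _ ↦ ?_
  rw [lineVec_apply]
  rfl

end SmoothData

/-! ### The chart data of `(s, db, J)` are `C^∞` on the chart domain -/

section ChartData

variable {EN : Type*} [NormedAddCommGroup EN] [InnerProductSpace ℝ EN] [FiniteDimensional ℝ EN]
  [CompleteSpace EN] {HN : Type*} [TopologicalSpace HN] {IN : ModelWithCorners ℝ EN HN}
  {N : Type*} [TopologicalSpace N] [ChartedSpace HN N]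
  {ES : Type*} [NormedAddCommGroup ES] [InnerProductSpace ℝ ES] [FiniteDimensional ℝ ES]
  [CompleteSpace ES] {HS : Type*} [TopologicalSpace HS] {IS : ModelWithCorners ℝ ES HS}
  {S : Type*} [TopologicalSpace S] [ChartedSpace HS S]
  [IsManifold IN ∞ N] [IsManifold IS ∞ S] {s : MForm IN N ℝ 2} {b : S → N}

omit [FiniteDimensional ℝ EN] [CompleteSpace EN] in
/-- **The chart representative of a smooth form is `C^∞` on the whole chart target** (smoothness
of a form at the points of a chart source is `C^∞`-regularity of its representative in that chart,
`MForm.smoothAt_iff_contDiffWithinAt_inChart`). [folklore] -/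
theorem contDiffOn_inChart (hs : IsSmoothForm s) (x₀ : N) :
    ContDiffOn ℝ ∞ (s.inChart x₀) (extChartAt IN x₀).target := by
  intro w hw
  have hz : (extChartAt IN x₀).symm w ∈ (extChartAt IN x₀).source := (extChartAt IN x₀).map_target hw
  have h := (MForm.smoothAt_iff_contDiffWithinAt_inChart hz).1 ((isSmoothForm_iff_smoothAt s).1 hs _)
  rw [(extChartAt IN x₀).right_inv hw] at h
  exact h.mono (extChartAt_target_subset_range x₀)

omit [FiniteDimensional ℝ EN] [CompleteSpace EN] [FiniteDimensional ℝ ES] [CompleteSpace ES] [IsManifold IS ∞ S] in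
/-- **The chart form of a smooth `2`-form along a `C^∞` map is `C^∞`** on the chart domain
(`chartForm y₀ = s.inChart (b y₀) ∘ extChartAt (b y₀) ∘ b`). [folklore] -/
theorem contMDiffOn_chartForm (hs : IsSmoothForm s) (hb : ContMDiff IS IN ∞ b) (y₀ : S) :
    ContMDiffOn IS 𝓘(ℝ, EN [⋀^Fin 2]→L[ℝ] ℝ) ∞ (chartForm IN s b y₀) (chartDomain IN IS b y₀) := by
  have h1 : ContMDiffOn IS 𝓘(ℝ, EN) ∞ (fun y ↦ extChartAt IN (b y₀) (b y)) (chartDomain IN IS b y₀) :=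
    contMDiffOn_extChartAt.comp hb.contMDiffOn fun y hy ↦ apply_mem_source_of_mem_chartDomain hy
  intro y hy
  exact (contDiffOn_inChart hs (b y₀) _ ((extChartAt IN (b y₀)).map_source hy.2)).comp_contMDiffWithinAt
    (f := fun y ↦ extChartAt IN (b y₀) (b y)) (x := y) (h1 y hy)
    fun y' (hy' : y' ∈ chartDomain IN IS b y₀) ↦ (extChartAt IN (b y₀)).map_source hy'.2

omit [FiniteDimensional ℝ EN] [CompleteSpace EN] [FiniteDimensional ℝ ES] [CompleteSpace ES] [IsManifold IS ∞ S] in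
/-- **`y ↦ J(b y₀; b y)` is `C^∞`** on the chart domain (`J` is a `C^∞` section of `End(TN)`; its
coordinate expression is the fibre component in the trivialisation of `End(TN)` at `b y₀`,
`coordJ_eq_inCoordinates`). [folklore] -/
theorem contMDiffOn_coordJ_comp (J : AlmostComplexStructure IN ∞ N) (hb : ContMDiff IS IN ∞ b) (y₀ : S) :
    ContMDiffOn IS 𝓘(ℝ, EN →L[ℝ] EN) ∞ (fun y ↦ J.coordJ (b y₀) (b y)) (chartDomain IN IS b y₀) := by
  set e := trivializationAt (EN →L[ℝ] EN) (fun x : N ↦ TangentSpace IN x →L[ℝ] TangentSpace IN x) (b y₀) with he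
  have hmaps : MapsTo (fun x : N ↦ TotalSpace.mk' (EN →L[ℝ] EN)
      (E := fun x : N ↦ TangentSpace IN x →L[ℝ] TangentSpace IN x) x (J x)) (chartAt HN (b y₀)).source e.source := by
    intro x hx
    rw [e.mem_source, he, hom_trivializationAt_baseSet, TangentBundle.trivializationAt_baseSet]
    exact ⟨hx, hx⟩
  have h1 : ContMDiffOn IN 𝓘(ℝ, EN →L[ℝ] EN) ∞ (fun x : N ↦ (e (TotalSpace.mk' (EN →L[ℝ] EN)
      (E := fun x : N ↦ TangentSpace IN x →L[ℝ] TangentSpace IN x) x (J x))).2) (chartAt HN (b y₀)).source :=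
    ((e.contMDiffOn_iff hmaps).1 J.contMDiff.contMDiffOn).2
  have h2 := h1.comp hb.contMDiffOn fun y (hy : y ∈ chartDomain IN IS b y₀) ↦
    apply_mem_source_of_mem_chartDomain hy
  refine h2.congr fun y hy ↦ ?_
  rw [Function.comp_apply, J.coordJ_eq_inCoordinates hy.2]
  rfl

omit [FiniteDimensional ℝ EN] [CompleteSpace EN] [FiniteDimensional ℝ ES] [CompleteSpace ES] in
/-- **The chart derivative, applied to a fixed vector, is `C^∞`** on the chart domain: it is the
`C^∞` tangent map read in the `C^∞` tangent trivialisations (`chartDeriv_apply_eq_tangentMap`).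
[folklore] -/
theorem contMDiffOn_chartDeriv_apply (hb : ContMDiff IS IN ∞ b) (y₀ : S) (u : ES) :
    ContMDiffOn IS 𝓘(ℝ, EN) ∞ (fun y ↦ chartDeriv IN IS b y₀ y u) (chartDomain IN IS b y₀) := by
  set eS := trivializationAt ES (TangentSpace IS : S → Type _) y₀ with heS
  set eN := trivializationAt EN (TangentSpace IN : N → Type _) (b y₀) with heN
  have htm : ContMDiff IS.tangent IN.tangent ∞ (tangentMap IS IN b) :=
    hb.contMDiff_tangentMap (m := ∞) (by norm_num)
  -- `y ↦ (y, u)` read through `eS⁻¹` is a `C^∞` map into `TS` on the chart domain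
  have hsymm : ContMDiffOn (IS.prod 𝓘(ℝ, ES)) (IS.prod 𝓘(ℝ, ES)) ∞ eS.toOpenPartialHomeomorph.symm eS.target :=
    eS.contMDiffOn_symm
  have hpair : ContMDiffOn IS (IS.prod 𝓘(ℝ, ES)) ∞ (fun y : S ↦ (y, u)) (chartDomain IN IS b y₀) :=
    contMDiffOn_id.prodMk contMDiffOn_const
  have hin : MapsTo (fun y : S ↦ (y, u)) (chartDomain IN IS b y₀) eS.target := by
    intro y hy
    rw [eS.mem_target, heS, TangentBundle.trivializationAt_baseSet]
    exact mem_source_of_mem_chartDomain hy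
  have h1 : ContMDiffOn IS (IS.prod 𝓘(ℝ, ES)) ∞ (fun y : S ↦ eS.toOpenPartialHomeomorph.symm (y, u))
      (chartDomain IN IS b y₀) := hsymm.comp hpair hin
  have h2 : ContMDiffOn IS (IN.prod 𝓘(ℝ, EN)) ∞ (fun y : S ↦ tangentMap IS IN b (eS.toOpenPartialHomeomorph.symm (y, u)))
      (chartDomain IN IS b y₀) := htm.comp_contMDiffOn h1
  have hin2 : MapsTo (fun y : S ↦ tangentMap IS IN b (eS.toOpenPartialHomeomorph.symm (y, u)))
      (chartDomain IN IS b y₀) eN.source := by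
    intro y hy
    rw [eN.mem_source, heN, TangentBundle.trivializationAt_baseSet]
    change b (eS.toOpenPartialHomeomorph.symm (y, u)).proj ∈ _
    rw [eS.proj_symm_apply (hin hy)]
    exact apply_mem_source_of_mem_chartDomain hy
  have h3 : ContMDiffOn IS 𝓘(ℝ, EN) ∞
      (fun y : S ↦ (eN (tangentMap IS IN b (eS.toOpenPartialHomeomorph.symm (y, u)))).2) (chartDomain IN IS b y₀) :=
    ((eN.contMDiffOn_iff hin2).1 h2).2
  refine h3.congr fun y hy ↦ ?_
  rw [chartDeriv_apply_eq_tangentMap b hy u]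
  have hyb : y ∈ eS.baseSet := by
    rw [heS, TangentBundle.trivializationAt_baseSet]; exact mem_source_of_mem_chartDomain hy
  exact congrArg (fun p ↦ (eN (tangentMap IS IN b p)).2) (eS.mk_symm hyb u)

omit [FiniteDimensional ℝ EN] [CompleteSpace EN] [CompleteSpace ES] in
/-- **The chart derivative of a `C^∞` map is `C^∞` on the chart domain** as an operator-valued map
(a family of linear maps of a finite-dimensional space is `C^∞` in operator norm iff it is so
applied to each vector, `contDiffOn_clm_apply`, read in the chart at `y₀`). [folklore] -/
theorem contMDiffOn_chartDeriv (hb : ContMDiff IS IN ∞ b) (y₀ : S) :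
    ContMDiffOn IS 𝓘(ℝ, ES →L[ℝ] EN) ∞ (chartDeriv IN IS b y₀) (chartDomain IN IS b y₀) := by
  have hsub : chartDomain IN IS b y₀ ⊆ (extChartAt IS y₀).source := fun y hy ↦ hy.1
  rw [contMDiffOn_iff_of_subset_source' (y := chartDeriv IN IS b y₀ y₀) hsub
    (fun y _ ↦ by rw [extChartAt_source, chartAt_self_eq, OpenPartialHomeomorph.refl_source]; exact mem_univ _)]
  simp only [extChartAt_model_space_eq_id, PartialEquiv.refl_coe, Function.id_comp]
  refine contDiffOn_clm_apply.2 fun u ↦ ?_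
  have hu := contMDiffOn_chartDeriv_apply (IN := IN) hb y₀ u
  rw [contMDiffOn_iff_of_subset_source' (y := chartDeriv IN IS b y₀ y₀ u) hsub
    (fun y _ ↦ by rw [extChartAt_source, chartAt_self_eq, OpenPartialHomeomorph.refl_source]; exact mem_univ _)] at hu
  simp only [extChartAt_model_space_eq_id, PartialEquiv.refl_coe, Function.id_comp] at hu
  exact hu

/-- **The chart frame `y ↦ π_G'(y) n₀` is `C^∞`** on the chart domain. [cite: McDuffSalamon2017, §2.1 Lemma 2.1.1] -/
theorem contMDiffOn_chartFrame (hs : IsSmoothForm s) (hb : ContMDiff IS IN ∞ b)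
    (hbnd : ∀ y, PullbackNondegAt IS s b y) (n₀ : EN) (y₀ : S) :
    ContMDiffOn IS 𝓘(ℝ, EN) ∞ (chartFrame IS s b n₀ y₀) (chartDomain IN IS b y₀) :=
  (contMDiffOn_projG (contMDiffOn_chartForm hs hb y₀) (contMDiffOn_chartDeriv hb y₀)
    (chartForm_chartDeriv_nondeg hbnd y₀)).clm_apply contMDiffOn_const

/-- **The adapted complex structure of the chart data is `C^∞`** on the chart domain.
[cite: McDuffSalamon2017, Prop. 2.5.6] -/
theorem contMDiffOn_chartAdaptedJ (hs : IsSmoothForm s)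
    (hsnd : ∀ (x : N) (v : TangentSpace IN x), v ≠ 0 → ∃ w : TangentSpace IN x, s x ![v, w] ≠ 0)
    {J : AlmostComplexStructure IN ∞ N} (hJt : J.IsTamedBy s) (hb : ContMDiff IS IN ∞ b)
    (hbnd : ∀ y, PullbackNondegAt IS s b y) (y₀ : S) :
    ContMDiffOn IS 𝓘(ℝ, EN →L[ℝ] EN) ∞ (fun y ↦ adaptedJ (chartForm IN s b y₀ y) (chartDeriv IN IS b y₀ y)
      (J.coordJ (b y₀) (b y))) (chartDomain IN IS b y₀) :=
  contMDiffOn_adaptedJ (J := fun y ↦ J.coordJ (b y₀) (b y)) (contMDiffOn_chartForm hs hb y₀)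
    (contMDiffOn_chartDeriv hb y₀) (contMDiffOn_coordJ_comp J hb y₀) (chartForm_nondeg (nondeg_formAt hsnd) y₀)
    (chartForm_chartDeriv_nondeg hbnd y₀) (chartForm_coordJ_tame hJt y₀)

/-- **The chart expression `(y, z) ↦ z · (chart frame)` of the realisation map is `C^∞`** on
(chart domain of `y₀`) × `ℂ`. [folklore] -/
theorem contMDiffOn_chartLineVec (hs : IsSmoothForm s)
    (hsnd : ∀ (x : N) (v : TangentSpace IN x), v ≠ 0 → ∃ w : TangentSpace IN x, s x ![v, w] ≠ 0)
    {J : AlmostComplexStructure IN ∞ N} (hJt : J.IsTamedBy s) (hb : ContMDiff IS IN ∞ b)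
    (hbnd : ∀ y, PullbackNondegAt IS s b y) (n₀ : EN) (y₀ : S) :
    ContMDiffOn (IS.prod 𝓘(ℝ, ℂ)) 𝓘(ℝ, EN) ∞
      (fun q : S × ℂ ↦ lineVec (chartForm IN s b y₀ q.1) (chartDeriv IN IS b y₀ q.1)
        (J.coordJ (b y₀) (b q.1)) (chartFrame IS s b n₀ y₀ q.1) q.2)
      (chartDomain IN IS b y₀ ×ˢ univ) :=
  contMDiffOn_lineVec (a := chartForm IN s b y₀) (d := chartDeriv IN IS b y₀)
    (J := fun y ↦ J.coordJ (b y₀) (b y)) (n := chartFrame IS s b n₀ y₀)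
    (contMDiffOn_chartForm hs hb y₀) (contMDiffOn_chartDeriv hb y₀) (contMDiffOn_coordJ_comp J hb y₀)
    (contMDiffOn_chartFrame hs hb hbnd n₀ y₀) (chartForm_nondeg (nondeg_formAt hsnd) y₀)
    (chartForm_chartDeriv_nondeg hbnd y₀) (chartForm_coordJ_tame hJt y₀)

/-- **The raw frame is a `C^∞` map into the tangent bundle** on the chart domain: in the tangent
trivialisation at `b y₀` it reads `y ↦ (b y, chart frame)` (`tangentEquiv_rawFrame`). [folklore] -/
theorem contMDiffOn_totalSpaceMk_rawFrame (hs : IsSmoothForm s) (hb : ContMDiff IS IN ∞ b)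
    (hbnd : ∀ y, PullbackNondegAt IS s b y) (n₀ : EN) (y₀ : S) :
    ContMDiffOn IS IN.tangent ∞ (fun y ↦ (TotalSpace.mk' EN (b y) (rawFrame IS s b n₀ y₀ y :) : TangentBundle IN N))
      (chartDomain IN IS b y₀) := by
  set eN := trivializationAt EN (TangentSpace IN : N → Type _) (b y₀) with heN
  have hin : MapsTo (fun y ↦ (TotalSpace.mk' EN (b y) (rawFrame IS s b n₀ y₀ y :) : TangentBundle IN N))
      (chartDomain IN IS b y₀) eN.source := by
    intro y hy
    rw [eN.mem_source, heN, TangentBundle.trivializationAt_baseSet]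
    exact apply_mem_source_of_mem_chartDomain hy
  rw [ModelWithCorners.tangent, eN.contMDiffOn_iff hin]
  refine ⟨hb.contMDiffOn, (contMDiffOn_chartFrame hs hb hbnd n₀ y₀).congr fun y hy ↦ ?_⟩
  rw [← tangentEquiv_rawFrame s b hbnd n₀ hy]
  rfl

end ChartData

end SymplecticSplitting

end Literature.Geometry.Symplectic

end
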